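import Literature.Geometry.GeometricMeasureTheory.RectifiableImagePieceData

/-!
# Decomposition of rectifiable data into bi-Lipschitz pieces

Third brick of `f_# 𝓡_m ⊆ 𝓡_m` (Federer 4.1.30): admissible rectifiable data `(W, θ, ξ)`
(`IsRectifiableData`) are carried, up to an `𝓗^m`-null set, by countably many pairwise disjoint
**bi-Lipschitz pieces** `gⱼ(Eⱼ)` — `gⱼ : ℝᵐ → V` Lipschitz, `Eⱼ ⊆ ℝᵐ` measurable, `gⱼ`
anti-Lipschitz on `Eⱼ` and differentiable with injective differential at every point of `Eⱼ` —
on each of which the frame `ξ` spans the image of the differential almost everywhere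
(`IsRectifiableData.exists_pieces`). This is Federer's Lemma 3.2.18 in the form needed for the
area formula on `W` (3.2.20, 3.2.22) and for push-forwards (4.1.30).

Ingredients: Rademacher (`LipschitzWith.ae_differentiableAt`), Sard's lemma for Lipschitz maps
(`Literature.Analysis.Calculus.hausdorffMeasure_image_null_of_fderiv_not_injective`, transported
to `EuclideanSpace`), Mathlib's `exists_partition_approximatesLinearOn_of_hasFDerivWithinAt` with
the tolerance `c(A)/4` making each piece anti-Lipschitz, the sub-carrier and image tangent theorems
(`ae_span_eq_approxTangentCone_restrict_of_subset`, `ae_approxTangentCone_image_eq_range`), and a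
transfer of a.e. statements from `𝓗^m ⌞ g(E)` to Lebesgue measure on `E`
(`ae_restrict_comp_of_ae_restrict_image`).

Theorems only; no named facts.

## References

* H. Federer, *Geometric Measure Theory*, Springer 1969, 3.2.18, 3.2.19, 4.1.28, 4.1.30
  [Federer1969].
-/

noncomputable section

open scoped InnerProductSpace ENNReal NNReal Topology
open MeasureTheory MeasureTheory.Measure Set Function Filter Module InnerProductSpace TopologicalSpace
open Literature.Analysis.Calculus

namespace Literature.Geometry.GeometricMeasureTheory

/-! ### Injective linear maps: openness, anti-Lipschitz pieces -/

section Injective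

variable {P : Type*} [NormedAddCommGroup P] [NormedSpace ℝ P] [FiniteDimensional ℝ P]
  {V : Type*} [NormedAddCommGroup V] [NormedSpace ℝ V]

/-- **The injective linear maps form an open set** (finite-dimensional source): `L` is injective
iff `rank L ≥ dim P`, an open condition (`isOpen_setOf_nat_le_rank`). [folklore] -/
theorem isOpen_setOf_injective : IsOpen {L : P →L[ℝ] V | Injective L} := by
  have h : {L : P →L[ℝ] V | Injective L} =
      {L : P →L[ℝ] V | ((finrank ℝ P : ℕ) : Cardinal) ≤ (L : P →ₗ[ℝ] V).rank} := by
    ext L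
    simp only [mem_setOf_eq]
    constructor
    · intro hL
      change ((finrank ℝ P : ℕ) : Cardinal) ≤ Module.rank ℝ (LinearMap.range (L : P →ₗ[ℝ] V))
      rw [← finrank_eq_rank, ← LinearMap.finrank_range_of_inj hL]
    · intro hL
      have h1 : finrank ℝ P ≤ finrank ℝ (LinearMap.range (L : P →ₗ[ℝ] V)) := by
        change ((finrank ℝ P : ℕ) : Cardinal) ≤ Module.rank ℝ (LinearMap.range (L : P →ₗ[ℝ] V))
          at hL
        rw [← finrank_eq_rank] at hL
        exact_mod_cast hL
      have h2 := LinearMap.finrank_range_add_finrank_ker (L : P →ₗ[ℝ] V)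
      have h3 : finrank ℝ (LinearMap.ker (L : P →ₗ[ℝ] V)) = 0 := by omega
      rw [Submodule.finrank_eq_zero] at h3
      exact LinearMap.ker_eq_bot.1 h3
  rw [h]
  exact isOpen_setOf_nat_le_rank _

/-- The measurable set of points where a map is differentiable with injective differential.
[folklore] -/
theorem measurableSet_setOf_differentiableAt_injective [MeasurableSpace P] [BorelSpace P]
    [CompleteSpace V] (g : P → V) :
    MeasurableSet {u | DifferentiableAt ℝ g u ∧ Injective (fderiv ℝ g u)} :=
  (measurableSet_of_differentiableAt ℝ g).inter (isOpen_setOf_injective.measurableSet.preimage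
    (measurable_fderiv ℝ g))

/-- An injective linear map on a finite-dimensional space is bounded below:
`c ‖v‖ ≤ ‖L v‖` with `c > 0`. [folklore] -/
theorem exists_pos_mul_norm_le_of_injective {L : P →L[ℝ] V} (hL : Injective L) :
    ∃ c : ℝ≥0, 0 < c ∧ ∀ v, (c : ℝ) * ‖v‖ ≤ ‖L v‖ := by
  obtain ⟨K, hK0, hK⟩ := (L : P →ₗ[ℝ] V).exists_antilipschitzWith (LinearMap.ker_eq_bot.2 hL)
  refine ⟨K⁻¹, inv_pos.2 hK0, fun v => ?_⟩
  have h := hK.le_mul_dist v 0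
  simp only [dist_zero_right, LinearMap.map_zero, ContinuousLinearMap.coe_coe] at h
  rw [NNReal.coe_inv, inv_mul_le_iff₀ (by exact_mod_cast hK0)]
  exact h

omit [FiniteDimensional ℝ P] in
/-- On a piece where `g` is `c/4`-approximated by a linear map `A` with `‖A v‖ ≥ c ‖v‖`, the map
`g` is anti-Lipschitz with constant `2/c` (as `antilipschitz_restrict_of_approximatesLinearOn`,
for a general normed source). [folklore] -/
theorem antilipschitz_restrict_of_approximatesLinearOn' {g : P → V} {A : P →L[ℝ] V} {s : Set P}
    {c : ℝ≥0} (hc : 0 < c) (hA : ∀ v, (c : ℝ) * ‖v‖ ≤ ‖A v‖)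
    (happ : ApproximatesLinearOn g A s (c / 4)) : AntilipschitzWith (2 / c) (s.restrict g) := by
  refine AntilipschitzWith.of_le_mul_dist fun p q => ?_
  have h1 := happ p p.2 q q.2
  have h2 := hA ((p : P) - q)
  rw [Subtype.dist_eq, dist_eq_norm, dist_eq_norm]
  change ‖(p : P) - q‖ ≤ ↑(2 / c) * ‖g p - g q‖
  have h3 : ‖A ((p : P) - q)‖ ≤ ‖g p - g q‖ + ‖g p - g q - A ((p : P) - q)‖ :=
    calc ‖A ((p : P) - q)‖ = ‖(g p - g q) - (g p - g q - A ((p : P) - q))‖ := by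
          congr 1; abel
      _ ≤ ‖g p - g q‖ + ‖g p - g q - A ((p : P) - q)‖ := norm_sub_le _ _
  have hc' : (0 : ℝ) < c := hc
  rw [NNReal.coe_div, NNReal.coe_ofNat]
  rw [NNReal.coe_div, NNReal.coe_ofNat] at h1
  have h4 : (c : ℝ) * ‖(p : P) - q‖ ≤ ‖g p - g q‖ + c / 4 * ‖(p : P) - q‖ :=
    h2.trans (h3.trans (add_le_add le_rfl h1))
  have h5 : 0 ≤ (c : ℝ) * ‖(p : P) - q‖ := by positivity
  rw [div_mul_eq_mul_div, le_div_iff₀ hc']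
  nlinarith [h4, h5]

omit [NormedSpace ℝ P] [FiniteDimensional ℝ P] [NormedSpace ℝ V] in
/-- Anti-Lipschitz restrictions pass to subsets. [folklore] -/
theorem _root_.AntilipschitzWith.restrict_mono {g : P → V} {s t : Set P} {K : ℝ≥0}
    (h : AntilipschitzWith K (t.restrict g)) (hst : s ⊆ t) : AntilipschitzWith K (s.restrict g) :=
  AntilipschitzWith.of_le_mul_dist fun p q => by
    have := h.le_mul_dist ⟨p, hst p.2⟩ ⟨q, hst q.2⟩
    simpa [Subtype.dist_eq] using this

/-- **Anti-Lipschitz pieces of the good set of a map**: the set of points where `g : P → V` is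
differentiable with injective differential is covered by countably many pairwise disjoint
measurable pieces on each of which `g` is anti-Lipschitz
(`exists_partition_approximatesLinearOn_of_hasFDerivWithinAt` with tolerance `c(A)/4`).
[cite: Federer1969, 3.2.2, 3.2.18] -/
theorem exists_antilipschitz_pieces [MeasurableSpace P] [BorelSpace P] [SecondCountableTopology V]
    [CompleteSpace V] (g : P → V) :
    ∃ (t : ℕ → Set P) (K : ℕ → ℝ≥0), (∀ n, MeasurableSet (t n)) ∧ Pairwise (Disjoint on t) ∧
      (∀ n, t n ⊆ {u | DifferentiableAt ℝ g u ∧ Injective (fderiv ℝ g u)}) ∧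
      {u | DifferentiableAt ℝ g u ∧ Injective (fderiv ℝ g u)} ⊆ (⋃ n, t n) ∧
      ∀ n, AntilipschitzWith (K n) ((t n).restrict g) := by
  classical
  set S := {u | DifferentiableAt ℝ g u ∧ Injective (fderiv ℝ g u)} with hS
  have hSd : ∀ u ∈ S, HasFDerivWithinAt g (fderiv ℝ g u) S u := fun u hu =>
    hu.1.hasFDerivAt.hasFDerivWithinAt
  -- tolerance: a quarter of a lower bound of `A` (or `1` if `A` is not injective)
  have hcA : ∀ A : P →L[ℝ] V, ∃ c : ℝ≥0, 0 < c ∧ (Injective A → ∀ v, (c : ℝ) * ‖v‖ ≤ ‖A v‖) := by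
    intro A
    by_cases hA : Injective A
    · obtain ⟨c, hc, h⟩ := exists_pos_mul_norm_le_of_injective hA
      exact ⟨c, hc, fun _ => h⟩
    · exact ⟨1, one_pos, fun h => absurd h hA⟩
  choose c hc0 hc using hcA
  obtain ⟨t, A, hdisj, htm, hcov, happ, hAeq⟩ :=
    exists_partition_approximatesLinearOn_of_hasFDerivWithinAt g S (fun u => fderiv ℝ g u) hSd
      (fun A => c A / 4) (fun A => (div_pos (hc0 A) (by norm_num)).ne')
  refine ⟨fun n => S ∩ t n, fun n => 2 / c (A n), fun n =>
    (measurableSet_setOf_differentiableAt_injective g).inter (htm n),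
    fun i j hij => (hdisj hij).mono inter_subset_right inter_subset_right,
    fun n => inter_subset_left, fun u hu => ?_, fun n => ?_⟩
  · obtain ⟨n, hn⟩ := mem_iUnion.1 (hcov hu)
    exact mem_iUnion.2 ⟨n, hu, hn⟩
  · rcases (S ∩ t n).eq_empty_or_nonempty with he | hne
    · refine AntilipschitzWith.of_le_mul_dist fun p => ?_
      have : (p : P) ∈ (∅ : Set P) := he ▸ p.2
      exact absurd this (notMem_empty _)
    · have hSne : S.Nonempty := ⟨hne.some, hne.some_mem.1⟩
      obtain ⟨y, hy, hAy⟩ := hAeq hSne n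
      have hAinj : Injective (A n) := hAy ▸ hy.2
      exact antilipschitz_restrict_of_approximatesLinearOn' (hc0 _) (hc _ hAinj) (happ n)

end Injective

/-! ### Sard's lemma on `EuclideanSpace`; the bad set of a Lipschitz map has null image -/

section Sard

variable {V : Type*} [NormedAddCommGroup V] [NormedSpace ℝ V] [FiniteDimensional ℝ V]
  [MeasurableSpace V] [BorelSpace V] {m : ℕ}

omit [FiniteDimensional ℝ V] in
/-- Sard's lemma for Lipschitz maps of `ℝᵐ = EuclideanSpace ℝ (Fin m)` (transported from
`Fin m → ℝ`). [cite: Federer1969, 3.2.3] -/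
theorem hausdorffMeasure_image_null_of_fderiv_not_injective_euclidean
    {g : EuclideanSpace ℝ (Fin m) → V} {L : ℝ≥0} (hg : LipschitzWith L g) :
    (μH[m] : Measure V) (g '' {u | DifferentiableAt ℝ g u ∧ ¬ Injective (fderiv ℝ g u)}) = 0 := by
  let e := EuclideanSpace.equiv (Fin m) ℝ
  set g₁ : (Fin m → ℝ) → V := g ∘ e.symm with hg₁
  have hg₁L : LipschitzWith (L * ‖(e.symm : (Fin m → ℝ) →L[ℝ] EuclideanSpace ℝ (Fin m))‖₊) g₁ :=
    hg.comp (e.symm : (Fin m → ℝ) →L[ℝ] EuclideanSpace ℝ (Fin m)).lipschitz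
  have hS := Literature.Analysis.Calculus.hausdorffMeasure_image_null_of_fderiv_not_injective hg₁L
  rw [Fintype.card_fin] at hS
  refine measure_mono_null ?_ hS
  rintro _ ⟨u, ⟨hud, hui⟩, rfl⟩
  have hge : g = g₁ ∘ e := by
    funext v; simp [hg₁]
  have hd₁ : DifferentiableAt ℝ g₁ (e u) := by
    have : DifferentiableAt ℝ (g ∘ e.symm) (e u) :=
      (by simpa using hud : DifferentiableAt ℝ g (e.symm (e u))).comp _ e.symm.differentiableAt
    exact this
  refine ⟨e u, ⟨hd₁, fun hinj => hui ?_⟩, by simp [hg₁]⟩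
  have hfd : fderiv ℝ g u = (fderiv ℝ g₁ (e u)).comp (e : EuclideanSpace ℝ (Fin m) →L[ℝ] (Fin m → ℝ)) := by
    conv_lhs => rw [hge]
    rw [fderiv_comp u hd₁ e.differentiableAt, e.fderiv]
  rw [hfd]
  exact hinj.comp e.injective

/-- **The bad set of a Lipschitz map has `𝓗^m`-null image**: the points where `g` is not
differentiable (Lebesgue-null by Rademacher, hence with null image) or has non-injective
differential (Sard). [cite: Federer1969, 3.2.3, 3.1.6] -/
theorem hausdorffMeasure_image_compl_good_eq_zero {g : EuclideanSpace ℝ (Fin m) → V} {L : ℝ≥0}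
    (hg : LipschitzWith L g) :
    (μH[m] : Measure V) (g '' {u | DifferentiableAt ℝ g u ∧ Injective (fderiv ℝ g u)}ᶜ) = 0 := by
  have hsplit : {u | DifferentiableAt ℝ g u ∧ Injective (fderiv ℝ g u)}ᶜ ⊆
      {u | ¬ DifferentiableAt ℝ g u} ∪ {u | DifferentiableAt ℝ g u ∧ ¬ Injective (fderiv ℝ g u)} := by
    intro u hu
    by_cases hd : DifferentiableAt ℝ g u
    · exact Or.inr ⟨hd, fun hi => hu ⟨hd, hi⟩⟩
    · exact Or.inl hd
  refine measure_mono_null (image_mono hsplit) ?_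
  rw [image_union]
  refine measure_union_null ?_ (hausdorffMeasure_image_null_of_fderiv_not_injective_euclidean hg)
  have h0 : volume {u : EuclideanSpace ℝ (Fin m) | ¬ DifferentiableAt ℝ g u} = 0 :=
    ae_iff.1 (hg.ae_differentiableAt (μ := volume))
  refine nonpos_iff_eq_zero.1 ((hg.hausdorffMeasure_image_le (Nat.cast_nonneg m) _).trans ?_)
  have hvol : (μH[m] : Measure (EuclideanSpace ℝ (Fin m))) {u | ¬ DifferentiableAt ℝ g u} = 0 := by
    have hHE : (μHE[m] : Measure (EuclideanSpace ℝ (Fin m))) = volume :=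
      EuclideanSpace.euclideanHausdorffMeasure_eq_volume m
    have h1 : (μHE[m] : Measure (EuclideanSpace ℝ (Fin m))) {u | ¬ DifferentiableAt ℝ g u} = 0 := by
      rw [hHE, h0]
    rw [Measure.euclideanHausdorffMeasure_def, Measure.smul_apply, smul_eq_zero] at h1
    exact h1.resolve_left (Measure.addHaarScalarFactor_volume_hausdorffMeasure_ne_zero m)
  rw [hvol, mul_zero]

end Sard

/-! ### Transfer of almost-everywhere statements from the image to the parameters -/

section Transfer

variable {P : Type*} [NormedAddCommGroup P] [InnerProductSpace ℝ P] [FiniteDimensional ℝ P]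
  [MeasurableSpace P] [BorelSpace P]
  {V : Type*} [NormedAddCommGroup V] [InnerProductSpace ℝ V] [FiniteDimensional ℝ V]
  [MeasurableSpace V] [BorelSpace V] {f : P → V} {f' : P → P →L[ℝ] V} {s : Set P}

/-- **A.e. on the image implies a.e. on the parameters**: if a property holds for
`𝓗ᵈ ⌞ f(s)`-a.e. point (`d = dim P`), `f` injective and differentiable relative to the measurable
set `s` with injective differentials, then it holds at `f x` for Lebesgue-a.e. `x ∈ s` (the image
measure is `f_*(J f · vol ⌞ s)` with `J f > 0`, `restrict_map_withDensity_normDet`).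
[cite: Federer1969, 3.2.3, 3.2.5] -/
theorem ae_restrict_comp_of_ae_restrict_image (hs : MeasurableSet s)
    (hf' : ∀ x ∈ s, HasFDerivWithinAt f (f' x) s x) (hinj : ∀ x ∈ s, Injective (f' x))
    (hf : InjOn f s) {p : V → Prop}
    (h : ∀ᵐ y ∂((μHE[finrank ℝ P] : Measure V).restrict (f '' s)), p y) :
    ∀ᵐ x ∂(volume.restrict s), p (f x) := by
  set J : P → ℝ≥0∞ := fun x => ENNReal.ofReal (f' x : P →ₗ[ℝ] V).normDet with hJ
  rw [← restrict_map_withDensity_normDet hs hf' hinj hf] at h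
  -- a.e. for the parameter measure on the subtype
  have hemb := measurableEmbedding_restrict_of_hasFDerivWithinAt hs hf' hf
  have h1 : ∀ᵐ x : s ∂(Measure.comap ((↑) : s → P) ((volume : Measure P).withDensity J)),
      p (f (x : P)) :=
    (hemb.ae_map_iff).1 h
  -- down to `P`
  have h2 : ∀ᵐ x ∂(((volume : Measure P).withDensity J).restrict s), p (f x) := by
    rw [← map_comap_subtype_coe hs]
    exact ((MeasurableEmbedding.subtype_coe hs).ae_map_iff).2 h1
  rw [restrict_withDensity hs, ae_withDensity_iff' (aemeasurable_ofReal_normDet_fderivWithin hs hf')]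
    at h2
  rw [ae_restrict_iff' hs] at h2 ⊢
  filter_upwards [h2] with x hx hxs
  refine hx hxs ?_
  rw [Ne, ENNReal.ofReal_eq_zero, not_le]
  have : (f' x : P →ₗ[ℝ] V).normDet ≠ 0 := by
    rw [Ne, LinearMap.normDet_eq_zero_iff_ker_ne_bot, not_not]
    exact LinearMap.ker_eq_bot.2 (hinj x hxs)
  exact lt_of_le_of_ne (LinearMap.normDet_nonneg _) (Ne.symm this)

end Transfer

/-! ### The decomposition -/

section Pieces

variable {V : Type*} [NormedAddCommGroup V] [InnerProductSpace ℝ V] [FiniteDimensional ℝ V]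
  [MeasurableSpace V] [BorelSpace V] {Ω : Opens V} {m : ℕ}

/-- **Bi-Lipschitz pieces of admissible rectifiable data** (Federer 3.2.18 for `(W, θ, ξ)`): there
are measurable `Eⱼ ⊆ ℝᵐ` and Lipschitz `gⱼ : ℝᵐ → V`, anti-Lipschitz on `Eⱼ` and differentiable
with injective differential at each point of `Eⱼ`, whose images `gⱼ(Eⱼ) ⊆ W` are pairwise
disjoint and cover `W` up to an `𝓗^m`-null set, such that for `𝓗^m`-a.e. `y = gⱼ(u) ∈ gⱼ(Eⱼ)` the
frame `ξ(y)` is orthonormal with `span ξ(y) = im Dgⱼ(u)`. [cite: Federer1969, 3.2.18, 3.2.19, 4.1.28] -/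
theorem IsRectifiableData.exists_pieces {W : Set V} {θ : V → ℤ} {ξ : V → Fin m → V}
    (hd : IsRectifiableData Ω m W θ ξ) :
    ∃ (E : ℕ → Set (EuclideanSpace ℝ (Fin m))) (g : ℕ → EuclideanSpace ℝ (Fin m) → V)
      (L K : ℕ → ℝ≥0),
      (∀ j, MeasurableSet (E j)) ∧ (∀ j, LipschitzWith (L j) (g j)) ∧
      (∀ j, AntilipschitzWith (K j) ((E j).restrict (g j))) ∧
      (∀ j, ∀ u ∈ E j, DifferentiableAt ℝ (g j) u ∧ Injective (fderiv ℝ (g j) u)) ∧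
      (∀ j, g j '' E j ⊆ W) ∧ (∀ j, MeasurableSet (g j '' E j)) ∧
      Pairwise (Disjoint on fun j => g j '' E j) ∧
      (μHE[m] : Measure V) (W \ ⋃ j, g j '' E j) = 0 ∧
      ∀ j, ∀ᵐ y ∂((μHE[m] : Measure V).restrict (g j '' E j)), ∀ u ∈ E j, g j u = y →
        Orthonormal ℝ (ξ y) ∧
          ((Submodule.span ℝ (range (ξ y)) : Set V) = range (fderiv ℝ (g j) u)) := by
  classical
  obtain ⟨hWm, -, ⟨f, hf, hcov⟩, -, hξ⟩ := hd
  choose Lf hLf using hf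
  -- good sets and anti-Lipschitz pieces of each parametrisation
  have hP := fun i => exists_antilipschitz_pieces (g := f i)
  choose t K htm htdisj htS hSt htK using hP
  -- indexing of the pairs `(i, n)` by `ℕ`
  let ι : ℕ → ℕ × ℕ := Nat.unpair
  let J : ℕ → Set V := fun k => f (ι k).1 '' t (ι k).1 (ι k).2
  have hJd : ∀ i n, ∀ u ∈ t i n, HasFDerivWithinAt (f i) (fderiv ℝ (f i) u) (t i n) u :=
    fun i n u hu => ((htS i n hu).1.hasFDerivAt).hasFDerivWithinAt
  have hJinj : ∀ i n, InjOn (f i) (t i n) := fun i n a ha b hb h => by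
    have := (htK i n).injective (a₁ := ⟨a, ha⟩) (a₂ := ⟨b, hb⟩) (by simpa using h)
    exact congrArg Subtype.val this
  have hJm : ∀ k, MeasurableSet (J k) := fun k =>
    measurableSet_image_of_hasFDerivWithinAt (htm _ _) (hJd _ _) (hJinj _ _)
  -- disjointified image pieces and their parameter sets
  let I : ℕ → Set V := fun k => (W ∩ J k) \ ⋃ k' ∈ Finset.range k, J k'
  have hIm : ∀ k, MeasurableSet (I k) := fun k =>
    ((hWm.inter (hJm k)).diff (Finset.measurableSet_biUnion _ fun k' _ => hJm k'))
  let E : ℕ → Set (EuclideanSpace ℝ (Fin m)) := fun k => t (ι k).1 (ι k).2 ∩ f (ι k).1 ⁻¹' I k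
  let g : ℕ → EuclideanSpace ℝ (Fin m) → V := fun k => f (ι k).1
  have hEm : ∀ k, MeasurableSet (E k) := fun k =>
    (htm _ _).inter ((hLf _).continuous.measurable (hIm k))
  have hgE : ∀ k, g k '' E k = I k := by
    intro k
    apply Subset.antisymm
    · rintro _ ⟨u, hu, rfl⟩; exact hu.2
    · intro y hy
      obtain ⟨u, hu, rfl⟩ : y ∈ J k := hy.1.2
      exact ⟨u, ⟨hu, hy⟩, rfl⟩
  have hIW : ∀ k, I k ⊆ W := fun k y hy => hy.1.1
  have hIJ : ∀ k, I k ⊆ J k := fun k y hy => hy.1.2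
  have hdisjI : Pairwise (Disjoint on I) := by
    intro k k' hkk'
    wlog hlt : k' < k generalizing k k'
    · exact (this hkk'.symm (lt_of_le_of_ne (not_lt.1 hlt) hkk')).symm
    refine disjoint_left.2 fun y hy hy' => hy.2 ?_
    exact mem_biUnion (Finset.mem_range.2 hlt) (hIJ k' hy')
  refine ⟨E, g, fun k => Lf (ι k).1, fun k => K (ι k).1 (ι k).2, hEm, fun k => hLf _,
    fun k => (htK _ _).restrict_mono inter_subset_left,
    fun k u hu => htS _ _ hu.1, fun k => (hgE k).symm ▸ hIW k, fun k => (hgE k).symm ▸ hIm k,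
    fun k k' h => by simpa only [onFun, hgE] using hdisjI h, ?_, fun k => ?_⟩
  · -- the uncovered part: off all ranges, or in the image of a bad set
    have hsub : W \ (⋃ k, g k '' E k) ⊆ (W \ ⋃ i, range (f i)) ∪
        ⋃ i, f i '' {u | DifferentiableAt ℝ (f i) u ∧ Injective (fderiv ℝ (f i) u)}ᶜ := by
      intro y hy
      obtain ⟨hyW, hyU⟩ := hy
      simp only [hgE] at hyU
      by_cases hr : y ∈ ⋃ i, range (f i)
      · obtain ⟨i, u, rfl⟩ := mem_iUnion.1 hr |>.imp fun i h => h
        refine Or.inr (mem_iUnion.2 ⟨i, u, fun huS => hyU ?_, rfl⟩)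
        -- `u` lies in some piece `t i n`, so `f i u ∈ J (pair i n)`, hence in some `I k`
        obtain ⟨n, hn⟩ := mem_iUnion.1 (hSt i huS)
        have hyJ : ∃ k, f i u ∈ J k := ⟨Nat.pair i n, by
          simp only [J, ι, Nat.unpair_pair]; exact ⟨u, hn, rfl⟩⟩
        -- the least such `k`
        let k₀ := Nat.find hyJ
        have hk₀ : f i u ∈ J k₀ := Nat.find_spec hyJ
        have hmin : ∀ k' < k₀, f i u ∉ J k' := fun k' hk' => Nat.find_min hyJ hk'
        refine mem_iUnion.2 ⟨k₀, ⟨hyW, hk₀⟩, fun h => ?_⟩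
        obtain ⟨k', hk', hyk'⟩ := mem_iUnion₂.1 h
        exact hmin k' (Finset.mem_range.1 hk') hyk'
      · exact Or.inl ⟨hyW, hr⟩
    refine measure_mono_null hsub (measure_union_null hcov ?_)
    refine (measure_iUnion_null_iff).2 fun i => ?_
    have h0 := hausdorffMeasure_image_compl_good_eq_zero (hLf i)
    rw [Measure.euclideanHausdorffMeasure_def, Measure.smul_apply, h0, smul_zero]
  · -- the frame condition on the piece `I k = g k '' E k`
    have hsub : g k '' E k ⊆ W := (hgE k).symm ▸ hIW k
    have h1 := ae_span_eq_approxTangentCone_restrict_of_subset ⟨f, fun i => ⟨_, hLf i⟩, hcov⟩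
      ((hgE k).symm ▸ hIm k) hsub (ξ := ξ) (by
        filter_upwards [hξ] with x hx using hx.2)
    have hortho : ∀ᵐ y ∂((μHE[m] : Measure V).restrict (g k '' E k)), Orthonormal ℝ (ξ y) := by
      exact ae_mono (Measure.restrict_mono hsub le_rfl) (hξ.mono fun x hx => hx.1)
    have hgd : ∀ u ∈ E k, HasFDerivWithinAt (g k) (fderiv ℝ (g k) u) (E k) u := fun u hu =>
      ((htS _ _ hu.1).1.hasFDerivAt).hasFDerivWithinAt
    have hginj : ∀ u ∈ E k, Injective (fderiv ℝ (g k) u) := fun u hu => (htS _ _ hu.1).2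
    have h2 := ae_approxTangentCone_image_eq_range hgd hginj
      ((htK _ _).restrict_mono inter_subset_left) ((hLf (ι k).1).lipschitzOnWith (s := E k))
      ((hgE k).symm ▸ hIm k)
    filter_upwards [h1, hortho, h2] with y hy hyo hy2 u hu hgu
    exact ⟨hyo, by rw [hy, hy2 u hu hgu]⟩

end Pieces

end Literature.Geometry.GeometricMeasureTheory
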